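import Mathlib

/-!
# Stub `stub_unitMap` (E-a) for line `Sketch` of crux `FemtoCurvatureTwoPointC`

Pure real analysis. From an admissible finite-volume coupling `u L β` (positive, continuous in `β` on
`[β₀, ∞)`, freezing `u L · → 0` on every fixed torus `L ≥ 8`) obeying in-window comparability and the
averaged two-sided dyadic asymptotic-freedom step law, we build a CONTINUOUS unit map `a` (`a > 0`,
`a → 0`) whose scale `ℓ₀ / a β` is pinned to the exit of the perturbative window.

Construction: clamp `β ↦ max β β₀`; smoothed window indicators
`T k β = ∏_{8 ≤ L ≤ 8·2^k} φ (u L β)` with the Lipschitz clamp `φ t = max 0 (min 1 (2 - 2t/u₀))`;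
smoothed window count `J β = ∑ᶠ k, T k β` (a locally finite sum of continuous functions, local
finiteness being forced by the lower step bound); `a β = (4 · 2^{J β})⁻¹`, `ℓ₀ = 1`. The exit index
`k₀` of the window and the deep-window count `k₁` satisfy `k₁ ≤ J β ≤ k₀ ≤ k₁ + D₀` with
`D₀ = 1 + (2/u₀ + |κ₂| + κ₃)/κ₁` (comparability plus the lower step bound), which pins `4 · 2^{J β}`.
-/

set_option autoImplicit false

open Filter Topology

namespace Summit.QuantumFields.YangMills.Theorems.FemtoCurvatureTwoPointC

/-- The Lipschitz clamp `φ t = max 0 (min 1 (2 - 2 t / u₀))`: continuous, valued in `[0, 1]`,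
equal to `1` below `u₀ / 2` and vanishing at and above `u₀`. -/
theorem exists_clamp (u₀ : ℝ) (hu₀ : 0 < u₀) :
    ∃ φ : ℝ → ℝ, Continuous φ ∧ (∀ t, 0 ≤ φ t) ∧ (∀ t, φ t ≤ 1) ∧
      (∀ t, t ≤ u₀ / 2 → φ t = 1) ∧ (∀ t, φ t ≠ 0 → t < u₀) := by
  refine ⟨fun t => max 0 (min 1 (2 - 2 * t / u₀)), ?_, fun t => le_max_left _ _,
    fun t => max_le zero_le_one (min_le_left _ _), fun t ht => ?_, fun t ht => ?_⟩
  · exact continuous_const.max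
      (continuous_const.min (continuous_const.sub ((continuous_const.mul continuous_id).div_const _)))
  · have h1 : 2 * t / u₀ ≤ 1 := by rw [div_le_iff₀ hu₀]; linarith
    exact (congrArg (max 0) (min_eq_left (by linarith))).trans (max_eq_right zero_le_one)
  · by_contra h
    push Not at h
    have h2 : 2 ≤ 2 * t / u₀ := by rw [le_div_iff₀ hu₀]; linarith
    exact ht (max_eq_left ((min_le_right _ _).trans (by linarith)))

/-- The smoothed window indicators `T k β = ∏_{8 ≤ L ≤ 8·2^k} φ (v L β)`: continuous in `β`, valued
in `[0, 1]`, equal to `1` when every sub-box is below `u₀ / 2`, and nonzero only inside the window. -/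
theorem exists_smoothedWindow (v : ℕ → ℝ → ℝ) (u₀ : ℝ) (hu₀ : 0 < u₀)
    (hcont : ∀ L : ℕ, 8 ≤ L → Continuous (v L)) :
    ∃ T : ℕ → ℝ → ℝ, (∀ k, Continuous (T k)) ∧ (∀ k β, 0 ≤ T k β) ∧ (∀ k β, T k β ≤ 1) ∧
      (∀ (k : ℕ) (β : ℝ), (∀ M : ℕ, 8 ≤ M → M ≤ 8 * 2 ^ k → v M β ≤ u₀ / 2) → T k β = 1) ∧
      (∀ (k : ℕ) (β : ℝ), T k β ≠ 0 → ∀ M : ℕ, 8 ≤ M → M ≤ 8 * 2 ^ k → v M β ≤ u₀) := by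
  obtain ⟨φ, hφc, hφ0, hφ1, hφone, hφlt⟩ := exists_clamp u₀ hu₀
  refine ⟨fun k β => ∏ L ∈ Finset.Icc 8 (8 * 2 ^ k), φ (v L β), fun k => ?_, fun k β => ?_,
    fun k β => ?_, fun k β h => ?_, fun k β h M hM1 hM2 => ?_⟩
  · exact continuous_finsetProd _ fun L hL => hφc.comp (hcont L (Finset.mem_Icc.1 hL).1)
  · exact Finset.prod_nonneg fun L _ => hφ0 _
  · exact Finset.prod_le_one (fun L _ => hφ0 _) fun L _ => hφ1 _
  · exact Finset.prod_eq_one fun L hL =>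
      hφone _ (h L (Finset.mem_Icc.1 hL).1 (Finset.mem_Icc.1 hL).2)
  · exact (hφlt _ (Finset.prod_ne_zero_iff.1 h M (Finset.mem_Icc.2 ⟨hM1, hM2⟩))).le

/-- Exponential bound on the perturbative window forced by the lower dyadic step law: if the dyadic
box `8 · 2^m` is in the window then `m < ((w 8)⁻¹ + κ₃) / κ₁`. -/
theorem window_lt (w : ℕ → ℝ) (u₀ κ₁ κ₃ : ℝ) (hκ₁ : 0 < κ₁)
    (hpos : ∀ L : ℕ, 8 ≤ L → 0 < w L)
    (hstep : ∀ k m : ℕ, (∀ M : ℕ, 8 ≤ M → M ≤ 8 * 2 ^ (k + m) → w M ≤ u₀) →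
      κ₁ * m - κ₃ ≤ (w (8 * 2 ^ k))⁻¹ - (w (8 * 2 ^ (k + m)))⁻¹)
    (m : ℕ) (hm : ∀ M : ℕ, 8 ≤ M → M ≤ 8 * 2 ^ m → w M ≤ u₀) :
    (m : ℝ) < ((w 8)⁻¹ + κ₃) / κ₁ := by
  have h := hstep 0 m (by simpa only [zero_add] using hm)
  simp only [zero_add, pow_zero, mul_one] at h
  have hp : 0 < (w (8 * 2 ^ m))⁻¹ :=
    inv_pos.2 (hpos _ (Nat.le_mul_of_pos_right _ (Nat.two_pow_pos m)))
  rw [lt_div_iff₀ hκ₁]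
  linarith

/-- The exit index `k₀` of the window and the deep-window count `k₁` at a fixed `β` (here `w = u · β`
with `u 8 β ≤ u₀ / 2`): `1 ≤ k₁ ≤ k₀`, the box `8·2^(k₀-1)` is the last window box, every `k < k₁`
has all its sub-boxes below `u₀ / 2`, and the gap `k₀ - k₁` is at most `1 + (2/u₀ + |κ₂| + κ₃)/κ₁`
(comparability at the first sub-box above `u₀ / 2`, then the lower step bound up to the exit). -/
theorem exit_index (w : ℕ → ℝ) (u₀ κ₁ κ₂ κ₃ : ℝ) (hu₀ : 0 < u₀) (hκ₁ : 0 < κ₁) (hκ₃ : 0 ≤ κ₃)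
    (hpos : ∀ L : ℕ, 8 ≤ L → 0 < w L)
    (hcomp : ∀ L L' : ℕ, 8 ≤ L → L ≤ L' → L' ≤ 2 * L →
      (∀ M : ℕ, 8 ≤ M → M ≤ L → w M ≤ u₀) → (w L)⁻¹ - (w L')⁻¹ ≤ κ₂)
    (hstep : ∀ k m : ℕ, (∀ M : ℕ, 8 ≤ M → M ≤ 8 * 2 ^ (k + m) → w M ≤ u₀) →
      κ₁ * m - κ₃ ≤ (w (8 * 2 ^ k))⁻¹ - (w (8 * 2 ^ (k + m)))⁻¹)
    (h8 : w 8 ≤ u₀ / 2) :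
    ∃ k₀ k₁ : ℕ, 1 ≤ k₁ ∧ k₁ ≤ k₀ ∧
      (∀ M : ℕ, 8 ≤ M → M ≤ 8 * 2 ^ (k₀ - 1) → w M ≤ u₀) ∧
      ¬ (∀ M : ℕ, 8 ≤ M → M ≤ 8 * 2 ^ k₀ → w M ≤ u₀) ∧
      (∀ k : ℕ, (∀ M : ℕ, 8 ≤ M → M ≤ 8 * 2 ^ k → w M ≤ u₀) → k < k₀) ∧
      (∀ k : ℕ, k < k₁ → ∀ M : ℕ, 8 ≤ M → M ≤ 8 * 2 ^ k → w M ≤ u₀ / 2) ∧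
      (k₀ : ℝ) ≤ k₁ + (1 + (2 / u₀ + |κ₂| + κ₃) / κ₁) := by
  classical
  -- the window is finite
  have hex : ∃ k : ℕ, ¬ (∀ M : ℕ, 8 ≤ M → M ≤ 8 * 2 ^ k → w M ≤ u₀) := by
    obtain ⟨N, hN⟩ := exists_nat_gt (((w 8)⁻¹ + κ₃) / κ₁)
    exact ⟨N, fun h => lt_irrefl (N : ℝ) ((window_lt w u₀ κ₁ κ₃ hκ₁ hpos hstep N h).trans hN)⟩
  set k₀ := Nat.find hex with hk₀
  have hspec : ¬ (∀ M : ℕ, 8 ≤ M → M ≤ 8 * 2 ^ k₀ → w M ≤ u₀) := Nat.find_spec hex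
  have hmin : ∀ k, k < k₀ → ∀ M : ℕ, 8 ≤ M → M ≤ 8 * 2 ^ k → w M ≤ u₀ := fun k hk =>
    not_not.1 (Nat.find_min hex hk)
  -- windows are antitone in the box
  have mono : ∀ (c : ℝ) (k k' : ℕ), k ≤ k' → (∀ M : ℕ, 8 ≤ M → M ≤ 8 * 2 ^ k' → w M ≤ c) →
      ∀ M : ℕ, 8 ≤ M → M ≤ 8 * 2 ^ k → w M ≤ c := fun c k k' hkk' h M h1 h2 =>
    h M h1 (h2.trans (Nat.mul_le_mul_left 8 (Nat.pow_le_pow_right two_pos hkk')))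
  have hlt : ∀ k, (∀ M : ℕ, 8 ≤ M → M ≤ 8 * 2 ^ k → w M ≤ u₀) → k < k₀ := fun k hk =>
    lt_of_not_ge fun hle => hspec (mono u₀ k₀ k hle hk)
  have hhalf0 : ∀ M : ℕ, 8 ≤ M → M ≤ 8 * 2 ^ 0 → w M ≤ u₀ / 2 := by
    intro M h1 h2
    obtain rfl : M = 8 := le_antisymm (by simpa using h2) h1
    exact h8
  have h0 : ∀ M : ℕ, 8 ≤ M → M ≤ 8 * 2 ^ 0 → w M ≤ u₀ := fun M h1 h2 =>
    (hhalf0 M h1 h2).trans (by linarith)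
  have hk₀pos : 1 ≤ k₀ := hlt 0 h0
  have hwin : ∀ M : ℕ, 8 ≤ M → M ≤ 8 * 2 ^ (k₀ - 1) → w M ≤ u₀ :=
    hmin _ (Nat.sub_lt hk₀pos one_pos)
  have hex1 : ∃ k : ℕ, ¬ (∀ M : ℕ, 8 ≤ M → M ≤ 8 * 2 ^ k → w M ≤ u₀ / 2) :=
    ⟨k₀, fun h => hspec fun M h1 h2 => (h M h1 h2).trans (by linarith)⟩
  set k₁ := Nat.find hex1 with hk₁
  have hspec1 : ¬ (∀ M : ℕ, 8 ≤ M → M ≤ 8 * 2 ^ k₁ → w M ≤ u₀ / 2) := Nat.find_spec hex1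
  have hhalf : ∀ k, k < k₁ → ∀ M : ℕ, 8 ≤ M → M ≤ 8 * 2 ^ k → w M ≤ u₀ / 2 := fun k hk =>
    not_not.1 (Nat.find_min hex1 hk)
  have hk₁pos : 1 ≤ k₁ := (Nat.find_pos hex1).2 (not_not_intro hhalf0)
  have hk₁₀ : k₁ ≤ k₀ :=
    Nat.find_min' hex1 fun h => hspec fun M h1 h2 => (h M h1 h2).trans (by linarith)
  refine ⟨k₀, k₁, hk₁pos, hk₁₀, hwin, hspec, hlt, hhalf, ?_⟩
  -- the gap bound
  have hD : 0 ≤ (2 / u₀ + |κ₂| + κ₃) / κ₁ := by positivity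
  rcases hk₁₀.eq_or_lt with h | h
  · have : (k₁ : ℝ) = k₀ := by exact_mod_cast h
    linarith
  obtain ⟨L', hL'8, hL'le, hL'gt⟩ : ∃ L' : ℕ, 8 ≤ L' ∧ L' ≤ 8 * 2 ^ k₁ ∧ u₀ / 2 < w L' := by
    by_contra hc
    push Not at hc
    exact hspec1 hc
  -- the dyadic scale `8·2^j ≤ L' < 8·2^(j+1)`
  have hx : 1 ≤ L' / 8 := (Nat.le_div_iff_mul_le (by norm_num)).2 (by rw [Nat.one_mul]; exact hL'8)
  obtain ⟨j, hj1, hj2⟩ := exists_nat_pow_near hx one_lt_two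
  have hL'j : 8 * 2 ^ j ≤ L' := by
    rw [Nat.mul_comm]; exact (Nat.le_div_iff_mul_le (by norm_num)).1 hj1
  have hL'j2 : L' ≤ 2 * (8 * 2 ^ j) :=
    calc L' ≤ 2 ^ (j + 1) * 8 := ((Nat.div_lt_iff_lt_mul (by norm_num)).1 hj2).le
      _ = 2 * (8 * 2 ^ j) := by ring
  have hjk₁ : j ≤ k₁ := (Nat.pow_le_pow_iff_right one_lt_two).1
    (Nat.le_of_mul_le_mul_left (hL'j.trans hL'le) (by norm_num))
  have hjk₀ : j ≤ k₀ - 1 := hjk₁.trans (Nat.le_sub_one_of_lt h)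
  have hwinj : ∀ M : ℕ, 8 ≤ M → M ≤ 8 * 2 ^ j → w M ≤ u₀ := mono u₀ j (k₀ - 1) hjk₀ hwin
  have h8j : 8 ≤ 8 * 2 ^ j := Nat.le_mul_of_pos_right _ (Nat.two_pow_pos j)
  -- comparability at (8·2^j, L')
  have hc := hcomp (8 * 2 ^ j) L' h8j hL'j hL'j2 hwinj
  have hinvL' : (w L')⁻¹ < 2 / u₀ := by
    have := (inv_lt_inv₀ (hpos L' hL'8) (half_pos hu₀)).2 hL'gt
    rwa [inv_div] at this
  -- lower step bound from `8·2^j` to the exit box `8·2^(k₀-1)`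
  have hjsum : j + (k₀ - 1 - j) = k₀ - 1 := Nat.add_sub_of_le hjk₀
  have hs := hstep j (k₀ - 1 - j) (by rw [hjsum]; exact hwin)
  rw [hjsum] at hs
  have hposk : 0 < (w (8 * 2 ^ (k₀ - 1)))⁻¹ :=
    inv_pos.2 (hpos _ (Nat.le_mul_of_pos_right _ (Nat.two_pow_pos _)))
  have hcast : ((k₀ - 1 - j : ℕ) : ℝ) = (k₀ : ℝ) - 1 - j := by
    rw [Nat.cast_sub hjk₀, Nat.cast_sub hk₀pos, Nat.cast_one]
  rw [hcast] at hs
  have key : κ₁ * ((k₀ : ℝ) - 1 - j) < 2 / u₀ + |κ₂| + κ₃ := by linarith [le_abs_self κ₂]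
  have key2 : (k₀ : ℝ) - 1 - j < (2 / u₀ + |κ₂| + κ₃) / κ₁ := by
    rw [lt_div_iff₀ hκ₁]; linarith
  have hjr : (j : ℝ) ≤ k₁ := by exact_mod_cast hjk₁
  linarith

/-- Sandwich for a `[0,1]`-valued sequence with support below `k₀` and equal to `1` below `k₁`:
`k₁ ≤ ∑ᶠ k, t k ≤ k₀`. -/
theorem finsum_between (t : ℕ → ℝ) (k₀ k₁ : ℕ) (h0 : ∀ k, 0 ≤ t k) (h1 : ∀ k, t k ≤ 1)
    (hsupp : ∀ k, t k ≠ 0 → k < k₀) (hone : ∀ k, k < k₁ → t k = 1) :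
    (k₁ : ℝ) ≤ ∑ᶠ k, t k ∧ ∑ᶠ k, t k ≤ k₀ := by
  have hs : Function.support t ⊆ ↑(Finset.range k₀) := fun k hk =>
    Finset.mem_coe.2 (Finset.mem_range.2 (hsupp k hk))
  rw [finsum_eq_sum_of_support_subset t hs]
  have hk : k₁ ≤ k₀ := by
    by_contra h
    push Not at h
    exact lt_irrefl _ (hsupp k₀ (by rw [hone k₀ h]; exact one_ne_zero))
  constructor
  · calc (k₁ : ℝ) = ∑ k ∈ Finset.range k₁, (1 : ℝ) := by simp
      _ = ∑ k ∈ Finset.range k₁, t k :=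
          Finset.sum_congr rfl fun k hk => (hone k (Finset.mem_range.1 hk)).symm
      _ ≤ ∑ k ∈ Finset.range k₀, t k :=
          Finset.sum_le_sum_of_subset_of_nonneg (Finset.range_subset_range.2 hk) fun k _ _ => h0 k
  · calc ∑ k ∈ Finset.range k₀, t k ≤ ∑ k ∈ Finset.range k₀, (1 : ℝ) :=
          Finset.sum_le_sum fun k _ => h1 k
      _ = k₀ := by simp

/-- The pin arithmetic: `k₁ ≤ J ≤ k₀ ≤ k₁ + D₀` and `1 ≤ k₀` pin `4 · 2^J = 1 / (4 · 2^J)⁻¹` between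
`2^{-(D₀+1)} · 8 · 2^{k₀}` and `8 · 2^{k₀ - 1}`. -/
theorem pin_arith (J D₀ : ℝ) (k₀ k₁ : ℕ) (hk₀ : 1 ≤ k₀) (h1 : (k₁ : ℝ) ≤ J) (h2 : J ≤ k₀)
    (h3 : (k₀ : ℝ) ≤ k₁ + D₀) :
    1 / (4 * (2 : ℝ) ^ J)⁻¹ ≤ 8 * 2 ^ (k₀ - 1) ∧
      (8 : ℝ) * 2 ^ k₀ ≤ 2 ^ (D₀ + 1) * (1 / (4 * (2 : ℝ) ^ J)⁻¹) := by
  rw [one_div, inv_inv]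
  constructor
  · have h : (2 : ℝ) ^ J ≤ 2 ^ (k₀ : ℝ) := Real.rpow_le_rpow_of_exponent_le one_le_two h2
    rw [Real.rpow_natCast] at h
    have hk : (2 : ℝ) ^ k₀ = 2 * 2 ^ (k₀ - 1) := by
      rw [← pow_succ', Nat.sub_add_cancel hk₀]
    rw [hk] at h
    linarith
  · have h : (2 : ℝ) ^ (k₀ : ℝ) ≤ 2 ^ (D₀ + J) :=
      Real.rpow_le_rpow_of_exponent_le one_le_two (by linarith)
    rw [Real.rpow_natCast, Real.rpow_add two_pos] at h
    rw [Real.rpow_add two_pos, Real.rpow_one]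
    nlinarith [Real.rpow_pos_of_pos two_pos D₀, Real.rpow_pos_of_pos two_pos J]

/-- `(4 · 2^{J β})⁻¹ → 0` at `+∞` as soon as `J` eventually exceeds every natural number. -/
theorem tendsto_inv_four_mul_two_rpow (J : ℝ → ℝ) (hJ : ∀ K : ℕ, ∀ᶠ β in atTop, (K : ℝ) ≤ J β) :
    Tendsto (fun β => (4 * (2 : ℝ) ^ J β)⁻¹) atTop (𝓝 0) := by
  rw [Metric.tendsto_nhds]
  intro ε hε
  obtain ⟨K, hK⟩ := pow_unbounded_of_one_lt ε⁻¹ (one_lt_two : (1 : ℝ) < 2)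
  filter_upwards [hJ K] with β hβ
  have h2J : (2 : ℝ) ^ (K : ℝ) ≤ 2 ^ J β := Real.rpow_le_rpow_of_exponent_le one_le_two hβ
  rw [Real.rpow_natCast] at h2J
  have hpos : 0 < 4 * (2 : ℝ) ^ J β := by positivity
  rw [Real.dist_eq, sub_zero, abs_of_pos (inv_pos.2 hpos)]
  apply inv_lt_of_inv_lt₀ hε
  linarith [Real.rpow_pos_of_pos two_pos (J β)]

/-- Core of the construction, for a coupling `v` admissible on all of `ℝ` (the clamped coupling):
the smoothed window count gives a continuous, positive unit map tending to `0`, pinned (with `ℓ₀ = 1`)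
to the exit of the window past the threshold where the smallest box `8` is deep inside the window. -/
theorem unitMap_core (v : ℕ → ℝ → ℝ) (u₀ β₀ κ₁ κ₂ κ₃ : ℝ) (hu₀ : 0 < u₀) (hκ₁ : 0 < κ₁)
    (hκ₃ : 0 ≤ κ₃)
    (hpos : ∀ (L : ℕ) (β : ℝ), 8 ≤ L → 0 < v L β)
    (hcont : ∀ L : ℕ, 8 ≤ L → Continuous (v L))
    (hlim : ∀ L : ℕ, 8 ≤ L → Tendsto (v L) atTop (𝓝 0))
    (hcomp : ∀ (L L' : ℕ) (β : ℝ), 8 ≤ L → L ≤ L' → L' ≤ 2 * L →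
      (∀ M : ℕ, 8 ≤ M → M ≤ L → v M β ≤ u₀) → (v L β)⁻¹ - (v L' β)⁻¹ ≤ κ₂)
    (hstep : ∀ (k m : ℕ) (β : ℝ), (∀ M : ℕ, 8 ≤ M → M ≤ 8 * 2 ^ (k + m) → v M β ≤ u₀) →
      κ₁ * m - κ₃ ≤ (v (8 * 2 ^ k) β)⁻¹ - (v (8 * 2 ^ (k + m)) β)⁻¹) :
    ∃ (a : ℝ → ℝ) (β₁ D : ℝ), Continuous a ∧ (∀ β, 0 < a β) ∧ Tendsto a atTop (𝓝 0) ∧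
      β₀ ≤ β₁ ∧ 0 ≤ D ∧
      ∀ β : ℝ, β₁ ≤ β → ∃ k₀ : ℕ, 1 ≤ k₀ ∧
        (∀ M : ℕ, 8 ≤ M → M ≤ 8 * 2 ^ (k₀ - 1) → v M β ≤ u₀) ∧
        ¬ (∀ M : ℕ, 8 ≤ M → M ≤ 8 * 2 ^ k₀ → v M β ≤ u₀) ∧
        1 / a β ≤ 8 * 2 ^ (k₀ - 1) ∧ (8 : ℝ) * 2 ^ k₀ ≤ 2 ^ D * (1 / a β) := by
  obtain ⟨T, hTc, hT0, hT1, hTone, hTwin⟩ := exists_smoothedWindow v u₀ hu₀ hcont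
  -- every index in the support of `k ↦ T k β` lies in the (finite) window
  have hfin : ∀ (β : ℝ) (k : ℕ), T k β ≠ 0 → (k : ℝ) < ((v 8 β)⁻¹ + κ₃) / κ₁ := fun β k hk =>
    window_lt (fun L => v L β) u₀ κ₁ κ₃ hκ₁ (fun L hL => hpos L β hL) (fun k m h => hstep k m β h)
      k (hTwin k β hk)
  -- continuity of the smoothed window count (locally finite sum of continuous functions)
  have hJc : Continuous fun β => ∑ᶠ k, T k β := by
    refine continuous_finsum hTc fun β' => ?_
    have h8 := hpos 8 β' le_rfl
    obtain ⟨N, hN⟩ := exists_nat_gt ((2 * (v 8 β')⁻¹ + κ₃) / κ₁)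
    refine ⟨v 8 ⁻¹' Set.Ioi (v 8 β' / 2),
      (hcont 8 le_rfl).continuousAt.preimage_mem_nhds (Ioi_mem_nhds (half_lt_self h8)),
      (Set.finite_Iio N).subset ?_⟩
    rintro k ⟨β, hβs, hβU⟩
    have hβU' : v 8 β' / 2 < v 8 β := hβU
    have hinv : (v 8 β)⁻¹ ≤ 2 * (v 8 β')⁻¹ := by
      rw [← div_eq_mul_inv, ← inv_div]
      exact inv_anti₀ (half_pos h8) hβU'.le
    have hk : (k : ℝ) < N :=
      ((hfin β k hβs).trans_le (div_le_div_of_nonneg_right (by linarith) hκ₁.le)).trans hN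
    exact Set.mem_Iio.2 (by exact_mod_cast hk)
  -- the smoothed count eventually exceeds any `K` (freezing of the finitely many `v L`, `L ≤ 8·2^K`)
  have hJK : ∀ K : ℕ, ∀ᶠ β in atTop, (K : ℝ) ≤ ∑ᶠ k, T k β := by
    intro K
    have hev : ∀ᶠ β in atTop, ∀ L ∈ Finset.Icc 8 (8 * 2 ^ K), v L β ≤ u₀ / 2 :=
      (Filter.eventually_all_finset _).2 fun L hL =>
        (hlim L (Finset.mem_Icc.1 hL).1).eventually (eventually_le_nhds (half_pos hu₀))
    filter_upwards [hev] with β hβ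
    obtain ⟨N, hN⟩ := exists_nat_gt (((v 8 β)⁻¹ + κ₃) / κ₁)
    have hb := (finsum_between (fun k => T k β) N (K + 1) (fun k => hT0 k β) (fun k => hT1 k β)
      (fun k hk => by exact_mod_cast (hfin β k hk).trans hN)
      (fun k hk => hTone k β fun M hM1 hM2 => hβ M (Finset.mem_Icc.2 ⟨hM1, hM2.trans
        (Nat.mul_le_mul_left 8 (Nat.pow_le_pow_right two_pos (Nat.lt_succ_iff.1 hk)))⟩))).1
    push_cast at hb
    linarith
  -- threshold: the smallest box `8` is deep inside the window
  obtain ⟨β₁', hβ₁'⟩ : ∃ β₁' : ℝ, ∀ β, β₁' ≤ β → v 8 β ≤ u₀ / 2 :=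
    eventually_atTop.1 ((hlim 8 le_rfl).eventually (eventually_le_nhds (half_pos hu₀)))
  refine ⟨fun β => (4 * (2 : ℝ) ^ (∑ᶠ k, T k β))⁻¹, max β₀ β₁',
    (1 + (2 / u₀ + |κ₂| + κ₃) / κ₁) + 1, ?_, fun β => inv_pos.2 (by positivity),
    tendsto_inv_four_mul_two_rpow (fun β => ∑ᶠ k, T k β) hJK, le_max_left _ _, by positivity,
    fun β hβ => ?_⟩
  · exact (continuous_const.mul (continuous_const.rpow hJc fun _ => Or.inl two_ne_zero)).inv₀
      fun β => (mul_pos four_pos (Real.rpow_pos_of_pos two_pos _)).ne'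
  · obtain ⟨k₀, k₁, hk₁, hk₁₀, hwin, hnot, hlt, hhalf, hgap⟩ :=
      exit_index (fun L => v L β) u₀ κ₁ κ₂ κ₃ hu₀ hκ₁ hκ₃ (fun L hL => hpos L β hL)
        (fun L L' h1 h2 h3 h4 => hcomp L L' β h1 h2 h3 h4) (fun k m h => hstep k m β h)
        (hβ₁' β (le_of_max_le_right hβ))
    obtain ⟨hlo, hhi⟩ := finsum_between (fun k => T k β) k₀ k₁ (fun k => hT0 k β)
      (fun k => hT1 k β) (fun k hk => hlt k (hTwin k β hk)) (fun k hk => hTone k β (hhalf k hk))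
    exact ⟨k₀, hk₁.trans hk₁₀, hwin, hnot,
      pin_arith (∑ᶠ k, T k β) (1 + (2 / u₀ + |κ₂| + κ₃) / κ₁) k₀ k₁ (hk₁.trans hk₁₀) hlo hhi hgap⟩

/-- **E-a — the continuous pinned unit map.** An admissible coupling `u L β` (positive, continuous in
`β` on `[β₀, ∞)`, freezing on every fixed torus `L ≥ 8`) with in-window comparability and the
two-sided averaged dyadic step law has, for every `β` past a threshold `β₁ ≥ β₀`, a finite perturbative
window with `k₀ ≥ 1` dyadic boxes, and there is a CONTINUOUS unit map `a` (`a > 0`, `a → 0`) whose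
scale `ℓ₀ / a β` is pinned between `2^{-D} · 8·2^{k₀}` and the last window box `8·2^{k₀-1}`. -/
theorem stub_unitMap :
    ∀ (u : ℕ → ℝ → ℝ) (u₀ β₀ κ₁ κ₂ κ₃ : ℝ), 0 < u₀ → 0 < κ₁ → 0 ≤ κ₃ →
      (∀ (L : ℕ) (β : ℝ), 8 ≤ L → β₀ ≤ β → 0 < u L β) →
      (∀ L : ℕ, 8 ≤ L → ContinuousOn (u L) (Set.Ici β₀)) →
      (∀ L : ℕ, 8 ≤ L → Filter.Tendsto (u L) Filter.atTop (nhds 0)) →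
      (∀ (L L' : ℕ) (β : ℝ), β₀ ≤ β → 8 ≤ L → L ≤ L' → L' ≤ 2 * L →
          (∀ M : ℕ, 8 ≤ M → M ≤ L → u M β ≤ u₀) → |(u L β)⁻¹ - (u L' β)⁻¹| ≤ κ₂) →
      (∀ (k m : ℕ) (β : ℝ), β₀ ≤ β → (∀ M : ℕ, 8 ≤ M → M ≤ 8 * 2 ^ (k + m) → u M β ≤ u₀) →
          κ₁ * m - κ₃ ≤ (u (8 * 2 ^ k) β)⁻¹ - (u (8 * 2 ^ (k + m)) β)⁻¹ ∧
            (u (8 * 2 ^ k) β)⁻¹ - (u (8 * 2 ^ (k + m)) β)⁻¹ ≤ κ₂ * m + κ₃) →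
      ∃ (a : ℝ → ℝ) (β₁ ℓ₀ D : ℝ), Continuous a ∧ (∀ β, 0 < a β) ∧
        Filter.Tendsto a Filter.atTop (nhds 0) ∧ 0 < ℓ₀ ∧ β₀ ≤ β₁ ∧ 0 ≤ D ∧
        ∀ β : ℝ, β₁ ≤ β → ∃ k₀ : ℕ, 1 ≤ k₀ ∧
          (∀ M : ℕ, 8 ≤ M → M ≤ 8 * 2 ^ (k₀ - 1) → u M β ≤ u₀) ∧
          ¬ (∀ M : ℕ, 8 ≤ M → M ≤ 8 * 2 ^ k₀ → u M β ≤ u₀) ∧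
          ℓ₀ / a β ≤ 8 * 2 ^ (k₀ - 1) ∧ (8 : ℝ) * 2 ^ k₀ ≤ 2 ^ D * (ℓ₀ / a β) := by
  intro u u₀ β₀ κ₁ κ₂ κ₃ hu₀ hκ₁ hκ₃ hpos hcont hlim hcomp hstep
  have hm : ∀ β : ℝ, β₀ ≤ max β β₀ := fun β => le_max_right _ _
  -- the clamped coupling `β ↦ u L (max β β₀)` is admissible on all of `ℝ`
  have hlim' : ∀ L : ℕ, 8 ≤ L → Tendsto (fun β => u L (max β β₀)) atTop (𝓝 0) := by
    intro L hL
    refine (hlim L hL).congr' ?_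
    filter_upwards [eventually_ge_atTop β₀] with β hβ
    rw [max_eq_left hβ]
  have hcont' : ∀ L : ℕ, 8 ≤ L → Continuous fun β => u L (max β β₀) := fun L hL =>
    (hcont L hL).comp_continuous (continuous_id.max continuous_const) fun β => Set.mem_Ici.2 (hm β)
  obtain ⟨a, β₁, D, hac, hapos, halim, hβ₁, hD, hpin⟩ :=
    unitMap_core (fun L β => u L (max β β₀)) u₀ β₀ κ₁ κ₂ κ₃ hu₀ hκ₁ hκ₃
      (fun L β hL => hpos L _ hL (hm β)) hcont' hlim'
      (fun L L' β h1 h2 h3 h4 => (le_abs_self _).trans (hcomp L L' _ (hm β) h1 h2 h3 h4))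
      (fun k m β h => (hstep k m _ (hm β) h).1)
  refine ⟨a, β₁, 1, D, hac, hapos, halim, one_pos, hβ₁, hD, fun β hβ => ?_⟩
  obtain ⟨k₀, h1, h2, h3, h4, h5⟩ := hpin β hβ
  have hmax : max β β₀ = β := max_eq_left (hβ₁.trans hβ)
  simp only [hmax] at h2 h3
  exact ⟨k₀, h1, h2, h3, h4, h5⟩

end Summit.QuantumFields.YangMills.Theorems.FemtoCurvatureTwoPointC
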